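import Mathlib.LinearAlgebra.Eigenspace.Basic
import Mathlib.LinearAlgebra.Matrix.ToLinearEquiv
import Mathlib.LinearAlgebra.Matrix.NonsingularInverse
import Mathlib.FieldTheory.IsAlgClosed.Basic
import Mathlib.Algebra.Polynomial.Degree.SmallDegree
import Mathlib.Algebra.MvPolynomial.Rename
import Mathlib.Algebra.BigOperators.Field
import Literature.Computability.AlgebraicComplexity.AsymptoticRankZariskiClosed
import HarnessLib

/-!
# Generic `3 × 3 × 3` tensors restrict from `⟨3⟩ ⊕ ⟨1,2,1⟩` (Alman–Li 2026, proof of Prop. 4.3)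

Topic `Literature/Computability/AlgebraicComplexity`. First proof file towards the discharge of
`Literature.Computability.AlgebraicComplexity.AlmanLi2026_cor41` (J. Alman, B. Li, *Asymptotic
Rank Speedup Theorems, Revisited*, arXiv:2605.21738, Cor. 4.1: every `3 × 3 × 3` tensor has
`R̃(T) ≤ 3 + 2^{ω/3}`), see `AlmanLi2026ThreeByThreeProofs.lean`. Everything here is proved; there
are no definitions and no named facts.

## Content: the generic part of the proof of Prop. 4.3, made explicit

The printed proof of Prop. 4.3 (read from the held text `paper:arxiv-2605.21738`, p0009): "it
suffices to prove `T ≤ ⟨3⟩ ⊕ ⟨1,2,1⟩` for a generic `T` … we may first assume that the `z₁`-slice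
of `T` is a nonsingular matrix. By a change of basis, we assume that the `z₁`-slice is of the form
`x₁y₁ + x₂y₂ + x₃y₃`. Furthermore, we can assume the `z₂`-slice is a diagonalizable matrix … Now we
can write `T = ∑ᵢ xᵢyᵢ(z₁ + αᵢz₂) + (xMy)z₃` … Letting `λ` be one of the eigenvalues of `M`, then
`T = ∑ᵢ xᵢyᵢ(z₁ + αᵢz₂ + λz₃) + x(M − λI)y z₃` where the first summation can be restricted from
`⟨3⟩` and the second term is a matrix of rank at most `2`, which is a restriction of `⟨1,2,1⟩`."
Here, with the tree's coordinates (`T a b c`, slices `M_c = (T a b c)_{a,b}` along the THIRD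
mode, the paper's `⟨1,2,1⟩` being the tree's `matMulTensor K 2 1 1 = ∑_{j<2} e_{j1} ⊗ e_{j1} ⊗ e_{11}`
as recorded in `AlmanLi2026ThreeByThree.lean`):

* §A `exists_eq_sum_two_of_det_eq_zero` — a singular `3 × 3` matrix is a sum of two outer
  products (kernel vector, `Matrix.exists_mulVec_eq_zero_iff`).
* §B `exists_mul_eq_of_det_sub_smul_eq_zero` — the change of bases: `det M₀ ≠ 0` and three
  distinct roots `dᵢ` of `det(M₁ − λM₀)` give `M₀ = WU`, `M₁ = W diag(d) U` (eigenvectors of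
  `M₀⁻¹M₁` for distinct eigenvalues are independent, `Module.End.eigenvectors_linearIndependent'`).
* §C `restrictsTo_directSum_unit_matMul_of_eq`, `restrictsTo_of_generic_slices` — the displayed
  identity and the restriction `T ≤ ⟨3⟩ ⊕ ⟨1,2,1⟩` it yields.
* §D–E the algebra making "generic" a single polynomial condition: over an algebraically closed
  field a cubic factors (`exists_vieta_of_cubic`, two applications of `IsAlgClosed.exists_root`),
  its discriminant is `a⁴∏(rᵢ − rⱼ)²` (`disc_cubic_eq_of_vieta`), and
  `det(A − tB) = det A − te₁ + t²e₂ − t³ det B` for `3 × 3` matrices (`det_sub_smul_fin_three`).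
* §F `exists_polynomial_restrictsTo` — **there is a non-zero polynomial `p` in the `27` entries
  (`p = det M₀ · Disc_λ det(M₁ − λM₀)`) such that `p(T) ≠ 0 ⟹ T ≤ ⟨3⟩ ⊕ ⟨1,2,1⟩`** over an
  algebraically closed field; `exists_polynomial_restrictsTo_three` — the same simultaneously for
  the three mode orders used in the proof of Cor. 4.1 (product with two relabelled copies).

What is NOT here: the passage from generic to ALL tensors. The paper does it inside Prop. 4.3 by
"degeneration = Zariski closure of the restriction locus" (Strassen 1987 / BCS §20), which the tree
does not have; `AlmanLi2026ThreeByThreeProofs.lean` does it instead at the level of the asymptotic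
rank bound, using the tree's proved theorem that the sublevel sets `{R̃ ≤ r}` are Zariski-closed
(`chnvz_zariskiClosed_asymptoticRank_le_holds`, CHNVZ 2025, Thm 1.2). Accordingly the named fact
`AlmanLi2026_prop43` (the degeneration for every `T`) is not discharged by these files.

## References

* [AlmanLi2026] J. Alman, B. Li, *Asymptotic Rank Speedup Theorems, Revisited*, arXiv:2605.21738
  (2026), Prop. 4.3 and its proof, proof of Cor. 4.1.
-/

noncomputable section

open scoped BigOperators
open Matrix

namespace Literature.Computability.AlgebraicComplexity

/-! ## A. A singular `3 × 3` matrix is a sum of two outer products -/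

section RankTwo

variable {K : Type*} [Field K]

/-- A `3 × 3` matrix with a non-zero kernel vector `p`, `p k ≠ 0`, is the sum of the two outer
products `col_j ⊗ (e_j − (p_j/p_k) e_k)`, `j ≠ k` (column `k` is a combination of the other two).
[folklore] -/
theorem matrix_eq_sum_two_of_mulVec_eq_zero (N : Matrix (Fin 3) (Fin 3) K) (p : Fin 3 → K)
    (hp : N *ᵥ p = 0) (k : Fin 3) (hk : p k ≠ 0) (a b : Fin 3) :
    N a b = ∑ j : Fin 2, N a (k.succAbove j) *
      ((if k.succAbove j = b then 1 else 0) - p (k.succAbove j) / p k * (if k = b then 1 else 0)) := by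
  have hrow : ∑ j, N a j * p j = 0 := by
    have := congrFun hp a
    simpa [Matrix.mulVec, dotProduct] using this
  rw [Fin.sum_univ_succAbove _ k] at hrow
  by_cases hb : k = b
  · subst hb
    simp only [if_true, Fin.succAbove_ne, if_false, zero_sub, mul_neg]
    rw [Finset.sum_neg_distrib]
    have hk' : N a k = -(∑ j : Fin 2, N a (k.succAbove j) * p (k.succAbove j)) / p k := by
      field_simp
      linear_combination hrow
    rw [hk', neg_div, Finset.sum_div]
    congr 1
    refine Finset.sum_congr rfl fun j _ => ?_
    ring
  · simp only [hb, if_false, mul_zero, sub_zero]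
    -- `b = k.succAbove j₀` for a unique `j₀`
    obtain ⟨j₀, hj₀⟩ := Fin.exists_succAbove_eq (Ne.symm hb)
    rw [Finset.sum_eq_single j₀]
    · rw [hj₀, if_pos rfl, mul_one]
    · intro j _ hj
      rw [if_neg, mul_zero]
      intro h
      exact hj (Fin.succAbove_right_injective (h.trans hj₀.symm))
    · simp

/-- **A singular `3 × 3` matrix over a field is a sum of two outer products** (`rank ≤ 2`):
`det N = 0 ⟹ N = f₀ ⊗ g₀ + f₁ ⊗ g₁`. [folklore] -/
theorem exists_eq_sum_two_of_det_eq_zero (N : Matrix (Fin 3) (Fin 3) K) (hN : N.det = 0) :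
    ∃ f g : Fin 2 → Fin 3 → K, ∀ a b, N a b = ∑ j, f j a * g j b := by
  classical
  obtain ⟨p, hp0, hp⟩ := Matrix.exists_mulVec_eq_zero_iff.2 hN
  obtain ⟨k, hk⟩ : ∃ k, p k ≠ 0 := by
    by_contra h
    push Not at h
    exact hp0 (funext h)
  exact ⟨fun j a => N a (k.succAbove j),
    fun j b => (if k.succAbove j = b then 1 else 0) - p (k.succAbove j) / p k * (if k = b then 1 else 0),
    fun a b => matrix_eq_sum_two_of_mulVec_eq_zero N p hp k hk a b⟩

end RankTwo

/-! ## B. Simultaneous diagonalisation of a generic pencil `(M₀, M₁)` by equivalence -/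

section Pencil

variable {K : Type*} [Field K]

/-- **Generic pencils are diagonalisable by equivalence.** If `det M₀ ≠ 0` and the cubic
`λ ↦ det(M₁ − λ M₀)` has three distinct roots `d₀, d₁, d₂`, then `M₀ = W U` and
`M₁ = W · diag(d) · U` for some matrices `W, U` (columns of `P = U⁻¹`: eigenvectors `pᵢ`,
`M₁ pᵢ = dᵢ M₀ pᵢ`, linearly independent as eigenvectors of `M₀⁻¹ M₁` for distinct eigenvalues;
`W = M₀ P`). This is the change of bases "`z₁`-slice `= ∑ xᵢ yᵢ`, `z₂`-slice `= ∑ αᵢ xᵢ yᵢ`" of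
Alman–Li 2026, proof of Prop. 4.3. [cite: AlmanLi2026, Proposition 4.3 (proof)] -/
theorem exists_mul_eq_of_det_sub_smul_eq_zero (M₀ M₁ : Matrix (Fin 3) (Fin 3) K)
    (h₀ : M₀.det ≠ 0) (d : Fin 3 → K) (hd : Function.Injective d)
    (hroot : ∀ i, (M₁ - d i • M₀).det = 0) :
    ∃ W U : Matrix (Fin 3) (Fin 3) K, M₀ = W * U ∧ M₁ = W * Matrix.diagonal d * U := by
  classical
  -- eigenvectors
  have hex : ∀ i, ∃ v : Fin 3 → K, v ≠ 0 ∧ (M₁ - d i • M₀) *ᵥ v = 0 := fun i =>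
    Matrix.exists_mulVec_eq_zero_iff.2 (hroot i)
  choose p hp0 hp using hex
  have heig : ∀ i, M₁ *ᵥ p i = d i • (M₀ *ᵥ p i) := fun i => by
    have := hp i
    rw [Matrix.sub_mulVec, sub_eq_zero, Matrix.smul_mulVec] at this
    exact this
  have hU₀ : IsUnit M₀.det := isUnit_iff_ne_zero.2 h₀
  -- they are eigenvectors of `M₀⁻¹ M₁` for the distinct eigenvalues `d i`, hence independent
  have hlin : LinearIndependent K p := by
    refine Module.End.eigenvectors_linearIndependent' (Matrix.toLin' (M₀⁻¹ * M₁)) d hd p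
      fun i => ⟨?_, hp0 i⟩
    rw [Module.End.mem_eigenspace_iff, Matrix.toLin'_apply, ← Matrix.mulVec_mulVec, heig i,
      Matrix.mulVec_smul, Matrix.mulVec_mulVec, Matrix.nonsing_inv_mul _ hU₀, Matrix.one_mulVec]
  -- the matrix `P` with columns `p i` is invertible
  set P : Matrix (Fin 3) (Fin 3) K := Matrix.of fun a i => p i a with hP
  have hPcol : P.col = p := by
    funext i a
    rfl
  have hPunit : IsUnit P := Matrix.linearIndependent_cols_iff_isUnit.1 (hPcol ▸ hlin)
  have hPdet : IsUnit P.det := (Matrix.isUnit_iff_isUnit_det P).1 hPunit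
  -- `M₁ P = M₀ P diag(d)`
  have hMP : M₁ * P = M₀ * P * Matrix.diagonal d := by
    ext a i
    have h1 : (M₁ * P) a i = (M₁ *ᵥ p i) a := by
      simp [Matrix.mul_apply, Matrix.mulVec, dotProduct, hP]
    have h2 : (M₀ * P * Matrix.diagonal d) a i = d i * (M₀ *ᵥ p i) a := by
      rw [Matrix.mul_diagonal]
      simp [Matrix.mul_apply, Matrix.mulVec, dotProduct, hP, mul_comm]
    rw [h1, h2, heig i, Pi.smul_apply, smul_eq_mul]
  refine ⟨M₀ * P, P⁻¹, ?_, ?_⟩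
  · rw [Matrix.mul_assoc, Matrix.mul_nonsing_inv _ hPdet, Matrix.mul_one]
  · rw [← hMP, Matrix.mul_assoc, Matrix.mul_nonsing_inv _ hPdet, Matrix.mul_one]

end Pencil

/-! ## C. From the slice normal form to the restriction `T ≤ ⟨3⟩ ⊕ ⟨1,2,1⟩` -/

section Restriction

variable {K : Type*} [Field K] {ι κ μ : Type*}

/-- A tensor of the form `∑_{i<r} wᵢ ⊗ uᵢ ⊗ vᵢ + (∑_{j<s} fⱼ ⊗ gⱼ) ⊗ z` (a rank-`≤ r` tensor plus
a rank-`≤ s` matrix tensored with one vector in the third mode) is a restriction of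
`⟨r⟩ ⊕ ⟨s,1,1⟩_Bläser` (`matMulTensor K s 1 1 = ∑_{j<s} e_{j1} ⊗ e_{j1} ⊗ e_{11}`, the paper's
`⟨1,s,1⟩`): "the first summation can be restricted from `⟨3⟩` and the second term is a matrix of
rank at most `2`, which is a restriction of `⟨1,2,1⟩`" (Alman–Li 2026, proof of Prop. 4.3).
[cite: AlmanLi2026, Proposition 4.3 (proof)] -/
theorem restrictsTo_directSum_unit_matMul_of_eq (T : ι → κ → μ → K) {r s : ℕ}
    (w : Fin r → ι → K) (u : Fin r → κ → K) (v : Fin r → μ → K)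
    (f : Fin s → ι → K) (g : Fin s → κ → K) (z : μ → K)
    (h : ∀ a b c, T a b c = ∑ i, w i a * u i b * v i c + (∑ j, f j a * g j b) * z c) :
    TensorRestrictsTo (directSumTensor (unitTensor K r) (matMulTensor K s 1 1)) T := by
  classical
  refine ⟨fun a x => Sum.elim (fun i => w i a) (fun q => f q.1 a) x,
    fun b y => Sum.elim (fun i => u i b) (fun q => g q.1 b) y,
    fun c x => Sum.elim (fun i => v i c) (fun _ => z c) x, fun a b c => ?_⟩
  rw [h a b c]
  simp only [Fintype.sum_sum_type, Sum.elim_inl, Sum.elim_inr, directSumTensor_inl,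
    directSumTensor_inr, directSumTensor_inl_inr, directSumTensor_inr_inl, mul_zero,
    Finset.sum_const_zero, add_zero, zero_add]
  -- the two remaining mixed blocks `(inl, inl, inr)` and `(inr, inr, inl)` vanish too
  have e1 : ∀ (i i' : Fin r) (q : Fin 1 × Fin 1),
      directSumTensor (unitTensor K r) (matMulTensor K s 1 1) (Sum.inl i) (Sum.inl i') (Sum.inr q)
        = 0 := fun _ _ _ => rfl
  have e2 : ∀ (q : Fin s × Fin 1) (q' : Fin s × Fin 1) (i : Fin r),
      directSumTensor (unitTensor K r) (matMulTensor K s 1 1) (Sum.inr q) (Sum.inr q') (Sum.inl i)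
        = 0 := fun _ _ _ => rfl
  simp only [e1, e2, mul_zero, Finset.sum_const_zero, add_zero, zero_add]
  congr 1
  · -- the diagonal block
    refine Finset.sum_congr rfl fun i _ => ?_
    rw [Finset.sum_eq_single i, Finset.sum_eq_single i]
    · simp
    · intro i'' _ hi''
      simp [unitTensor_apply, Ne.symm hi'']
    · simp
    · intro i' _ hi'
      refine Finset.sum_eq_zero fun i'' _ => ?_
      simp [unitTensor_apply, Ne.symm hi']
    · simp
  · -- the matrix block
    rw [Finset.sum_mul]
    simp only [Fintype.sum_prod_type, Finset.univ_unique, Finset.sum_singleton, matMulTensor]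
    refine Finset.sum_congr rfl fun j _ => ?_
    rw [Finset.sum_eq_single j]
    · simp
    · intro j' _ hj'
      simp [Ne.symm hj']
    · simp

/-- **The generic restriction** (Alman–Li 2026, proof of Prop. 4.3, over an arbitrary field once the
eigenvalues are available): if the `z₀`-slice `M₀` of `T ∈ K^{3×3×3}` is non-singular, the cubic
`det(M₁ − λ M₀)` of the pencil with the `z₁`-slice has three distinct roots `dᵢ ∈ K`, and
`det(M₂ − l M₀) = 0` for some `l ∈ K`, then
`T = ∑ᵢ wᵢ ⊗ uᵢ ⊗ (z₀ + dᵢ z₁ + l z₂) + (M₂ − l M₀) ⊗ z₂` with `rank (M₂ − l M₀) ≤ 2`, so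
`T ≤ ⟨3⟩ ⊕ ⟨1,2,1⟩`. [cite: AlmanLi2026, Proposition 4.3 (proof)] -/
theorem restrictsTo_of_generic_slices (T : Fin 3 → Fin 3 → Fin 3 → K)
    (h₀ : (Matrix.of fun a b => T a b 0).det ≠ 0) (d : Fin 3 → K) (hd : Function.Injective d)
    (hroot : ∀ i, ((Matrix.of fun a b => T a b 1) - d i • (Matrix.of fun a b => T a b 0)).det = 0)
    (l : K) (hl : ((Matrix.of fun a b => T a b 2) - l • (Matrix.of fun a b => T a b 0)).det = 0) :
    TensorRestrictsTo (directSumTensor (unitTensor K 3) (matMulTensor K 2 1 1)) T := by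
  classical
  obtain ⟨W, U, hWU, hWDU⟩ := exists_mul_eq_of_det_sub_smul_eq_zero _ _ h₀ d hd hroot
  obtain ⟨f, g, hfg⟩ := exists_eq_sum_two_of_det_eq_zero _ hl
  refine restrictsTo_directSum_unit_matMul_of_eq T (fun i a => W a i) (fun i b => U i b)
    (fun i c => ![(1 : K), d i, l] c) f g (fun c => ![(0 : K), 0, 1] c) fun a b c => ?_
  have e0 : T a b 0 = ∑ i, W a i * U i b := by
    have := congrFun (congrFun hWU a) b
    simpa [Matrix.mul_apply] using this
  have e1 : T a b 1 = ∑ i, W a i * d i * U i b := by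
    have := congrFun (congrFun hWDU a) b
    rw [Matrix.mul_apply] at this
    simpa [Matrix.mul_diagonal] using this
  have e2 : T a b 2 = l * T a b 0 + ∑ j, f j a * g j b := by
    have := hfg a b
    simp only [Matrix.sub_apply, Matrix.smul_apply, Matrix.of_apply, smul_eq_mul] at this
    linear_combination this
  fin_cases c
  · show T a b 0 = ∑ i, W a i * U i b * 1 + (∑ j, f j a * g j b) * 0
    rw [e0, mul_zero, add_zero]
    exact Finset.sum_congr rfl fun i _ => (mul_one _).symm
  · show T a b 1 = ∑ i, W a i * U i b * d i + (∑ j, f j a * g j b) * 0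
    rw [e1, mul_zero, add_zero]
    exact Finset.sum_congr rfl fun i _ => by ring
  · show T a b 2 = ∑ i, W a i * U i b * l + (∑ j, f j a * g j b) * 1
    rw [e2, e0, Finset.mul_sum, mul_one]
    congr 1
    exact Finset.sum_congr rfl fun i _ => by ring

end Restriction

/-! ## D. Cubics over an algebraically closed field: roots, Vieta, discriminant -/

section Cubic

/-- **Discriminant of a cubic in terms of its roots**: if `b = -a σ₁`, `c = a σ₂`, `d = -a σ₃`
(Vieta for `a (x - r₁)(x - r₂)(x - r₃)`), then
`b²c² − 4ac³ − 4b³d − 27a²d² + 18abcd = a⁴ (r₁−r₂)² (r₁−r₃)² (r₂−r₃)²`. [folklore] -/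
theorem disc_cubic_eq_of_vieta {R : Type*} [CommRing R] {a b c d r₁ r₂ r₃ : R}
    (hb : b = -(a * (r₁ + r₂ + r₃))) (hc : c = a * (r₁ * r₂ + r₁ * r₃ + r₂ * r₃))
    (hd : d = -(a * r₁ * r₂ * r₃)) :
    b ^ 2 * c ^ 2 - 4 * a * c ^ 3 - 4 * b ^ 3 * d - 27 * a ^ 2 * d ^ 2 + 18 * a * b * c * d =
      a ^ 4 * ((r₁ - r₂) ^ 2 * (r₁ - r₃) ^ 2 * (r₂ - r₃) ^ 2) := by
  subst hb hc hd
  ring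

variable {K : Type*} [Field K]

/-- **A cubic over an algebraically closed field has three roots** (with multiplicity), in Vieta
form: `a x³ + b x² + c x + d = a (x − r₁)(x − r₂)(x − r₃)`, i.e. `b = −a(r₁+r₂+r₃)`,
`c = a(r₁r₂+r₁r₃+r₂r₃)`, `d = −a r₁r₂r₃` (a root `r₁` of the cubic, a root `r₂` of the quotient
quadratic, `r₃ = −b/a − r₁ − r₂`). [folklore] -/
theorem exists_vieta_of_cubic [IsAlgClosed K] (a b c d : K) (ha : a ≠ 0) :
    ∃ r₁ r₂ r₃ : K, b = -(a * (r₁ + r₂ + r₃)) ∧ c = a * (r₁ * r₂ + r₁ * r₃ + r₂ * r₃) ∧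
      d = -(a * r₁ * r₂ * r₃) := by
  obtain ⟨r₁, hr₁⟩ := IsAlgClosed.exists_root
    (Polynomial.C a * Polynomial.X ^ 3 + Polynomial.C b * Polynomial.X ^ 2 +
      Polynomial.C c * Polynomial.X + Polynomial.C d)
    (by rw [Polynomial.degree_cubic ha]; norm_num)
  have h1 : a * r₁ ^ 3 + b * r₁ ^ 2 + c * r₁ + d = 0 := by
    have := hr₁.eq_zero
    simpa using this
  obtain ⟨r₂, hr₂⟩ := IsAlgClosed.exists_root
    (Polynomial.C a * Polynomial.X ^ 2 + Polynomial.C (b + a * r₁) * Polynomial.X +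
      Polynomial.C (c + b * r₁ + a * r₁ ^ 2))
    (by rw [Polynomial.degree_quadratic ha]; norm_num)
  have h2 : a * r₂ ^ 2 + (b + a * r₁) * r₂ + (c + b * r₁ + a * r₁ ^ 2) = 0 := by
    have := hr₂.eq_zero
    simpa using this
  set r₃ : K := -(b / a) - r₁ - r₂ with hr₃def
  have hr₃ : a * r₃ = -b - a * r₁ - a * r₂ := by
    rw [hr₃def]
    field_simp
  have hV1 : b = -(a * (r₁ + r₂ + r₃)) := by linear_combination hr₃
  have hV2 : c = a * (r₁ * r₂ + r₁ * r₃ + r₂ * r₃) := by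
    linear_combination h2 - (r₁ + r₂) * hr₃
  have hV3 : d = -(a * r₁ * r₂ * r₃) := by
    linear_combination h1 - r₁ * hV2 - r₁ ^ 2 * hr₃
  exact ⟨r₁, r₂, r₃, hV1, hV2, hV3⟩

/-- Three pairwise distinct elements give an injective `Fin 3`-indexed family. [folklore] -/
theorem injective_vec_three {α : Type*} {x y z : α} (hxy : x ≠ y) (hxz : x ≠ z) (hyz : y ≠ z) :
    Function.Injective ![x, y, z] := by
  intro i j h
  fin_cases i <;> fin_cases j
  · rfl
  · exact absurd (by simpa using h) hxy
  · exact absurd (by simpa using h) hxz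
  · exact absurd (by simpa using h) hxy.symm
  · rfl
  · exact absurd (by simpa using h) hyz
  · exact absurd (by simpa using h) hxz.symm
  · exact absurd (by simpa using h) hyz.symm
  · rfl

end Cubic

/-! ## E. The cubic of a `3 × 3` pencil: `det(A − t B)` expanded in `t` -/

section PencilDet

/-- **Expansion of `det(A − tB)` for `3 × 3` matrices**:
`det(A − tB) = det A − t e₁ + t² e₂ − t³ det B` with `e₁ = ∑ⱼ det(A | colⱼ ← B colⱼ)` and
`e₂ = ∑ⱼ det(B | colⱼ ← A colⱼ)` (multilinearity in the columns). [folklore] -/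
theorem det_sub_smul_fin_three {R : Type*} [CommRing R] (A B : Matrix (Fin 3) (Fin 3) R) (t : R) :
    (A - t • B).det = A.det - t * (∑ j, (A.updateCol j fun i => B i j).det)
      + t ^ 2 * (∑ j, (B.updateCol j fun i => A i j).det) - t ^ 3 * B.det := by
  simp [Matrix.det_fin_three, Fin.sum_univ_three, Matrix.updateCol_apply]
  ring

variable {K : Type*} [Field K]

/-- `e₁(diag d, 1) = d₁d₂ + d₀d₂ + d₀d₁` (the witness computation for the genericity polynomial).
[folklore] -/
theorem sum_det_updateCol_diagonal_one (d : Fin 3 → K) :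
    ∑ j, ((Matrix.diagonal d).updateCol j fun i => (1 : Matrix (Fin 3) (Fin 3) K) i j).det =
      d 1 * d 2 + d 0 * d 2 + d 0 * d 1 := by
  simp [Matrix.det_fin_three, Fin.sum_univ_three, Matrix.updateCol_apply, Matrix.one_apply]

/-- `e₂(diag d, 1) = d₀ + d₁ + d₂`. [folklore] -/
theorem sum_det_updateCol_one_diagonal (d : Fin 3 → K) :
    ∑ j, ((1 : Matrix (Fin 3) (Fin 3) K).updateCol j fun i => Matrix.diagonal d i j).det =
      d 0 + d 1 + d 2 := by
  simp [Matrix.det_fin_three, Fin.sum_univ_three, Matrix.updateCol_apply, Matrix.diagonal_apply]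

end PencilDet

/-! ## F. The genericity polynomial and the generic restriction theorem -/

section Generic

variable (K : Type*) [Field K] [IsAlgClosed K]

/-- **Generic `3 × 3 × 3` tensors over an algebraically closed field restrict from
`⟨3⟩ ⊕ ⟨1,2,1⟩`** (Alman–Li 2026, proof of Prop. 4.3: "it suffices to prove
`T ≤ ⟨3⟩ ⊕ ⟨1,2,1⟩` for a generic `T`"), with the genericity made explicit as the non-vanishing
of ONE non-zero polynomial `p` in the `27` entries: `p = det M₀ · Disc_λ det(M₁ − λ M₀)`
(`M_c` the `z_c`-slices; non-zero at `M₀ = 1`, `M₁ = diag(d)` with distinct `dᵢ`, which exist as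
`K` is infinite). If `p(T) ≠ 0` then `M₀` is non-singular and `M₀⁻¹M₁` has three distinct
eigenvalues ("we can assume the `z₂`-slice is a diagonalizable matrix"), and an eigenvalue `λ` of
the third slice exists since `K` is algebraically closed; `restrictsTo_of_generic_slices`
concludes. [cite: AlmanLi2026, Proposition 4.3 (proof)] -/
theorem exists_polynomial_restrictsTo :
    ∃ p : MvPolynomial (Fin 3 × Fin 3 × Fin 3) K, p ≠ 0 ∧
      ∀ T : Fin 3 → Fin 3 → Fin 3 → K, MvPolynomial.eval (tensorEntries T) p ≠ 0 →
        TensorRestrictsTo (directSumTensor (unitTensor K 3) (matMulTensor K 2 1 1)) T := by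
  classical
  -- generic slices `X c = (X_{abc})_{a,b}` over the polynomial ring in the 27 entries
  let X : Fin 3 → Matrix (Fin 3) (Fin 3) (MvPolynomial (Fin 3 × Fin 3 × Fin 3) K) :=
    fun c => Matrix.of fun a b => MvPolynomial.X (a, b, c)
  -- coefficients of the cubic `det(X 1 - x • X 0) = det X₁ - e₁ x + e₂ x² - det X₀ x³`
  let e₁ : MvPolynomial (Fin 3 × Fin 3 × Fin 3) K := ∑ j, ((X 1).updateCol j fun i => X 0 i j).det
  let e₂ : MvPolynomial (Fin 3 × Fin 3 × Fin 3) K := ∑ j, ((X 0).updateCol j fun i => X 1 i j).det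
  -- discriminant of `a x³ + b x² + c x + d`, `(a, b, c, d) = (-det X₀, e₂, -e₁, det X₁)`
  let Δ : MvPolynomial (Fin 3 × Fin 3 × Fin 3) K :=
    e₂ ^ 2 * (-e₁) ^ 2 - 4 * (-(X 0).det) * (-e₁) ^ 3 - 4 * e₂ ^ 3 * (X 1).det
      - 27 * (-(X 0).det) ^ 2 * (X 1).det ^ 2 + 18 * (-(X 0).det) * e₂ * (-e₁) * (X 1).det
  -- evaluation at a tensor `T`
  have hdet : ∀ (T : Fin 3 → Fin 3 → Fin 3 → K) (c : Fin 3),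
      MvPolynomial.eval (tensorEntries T) (X c).det = (Matrix.of fun a b => T a b c).det := by
    intro T c
    rw [RingHom.map_det]
    congr 1
    ext a b
    simp [X, tensorEntries]
  have he₁ : ∀ T : Fin 3 → Fin 3 → Fin 3 → K, MvPolynomial.eval (tensorEntries T) e₁ =
      ∑ j, ((Matrix.of fun a b => T a b 1).updateCol j
        fun i => (Matrix.of fun a b => T a b 0) i j).det := by
    intro T
    simp only [e₁, map_sum, RingHom.map_det]
    refine Finset.sum_congr rfl fun j _ => ?_
    congr 1
    ext a b
    simp only [RingHom.mapMatrix_apply, Matrix.map_apply, Matrix.updateCol_apply, Matrix.of_apply]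
    split_ifs <;> simp [X, tensorEntries]
  have he₂ : ∀ T : Fin 3 → Fin 3 → Fin 3 → K, MvPolynomial.eval (tensorEntries T) e₂ =
      ∑ j, ((Matrix.of fun a b => T a b 0).updateCol j
        fun i => (Matrix.of fun a b => T a b 1) i j).det := by
    intro T
    simp only [e₂, map_sum, RingHom.map_det]
    refine Finset.sum_congr rfl fun j _ => ?_
    congr 1
    ext a b
    simp only [RingHom.mapMatrix_apply, Matrix.map_apply, Matrix.updateCol_apply, Matrix.of_apply]
    split_ifs <;> simp [X, tensorEntries]
  have hΔ : ∀ T : Fin 3 → Fin 3 → Fin 3 → K, MvPolynomial.eval (tensorEntries T) Δ =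
      (MvPolynomial.eval (tensorEntries T) e₂) ^ 2 * (-(MvPolynomial.eval (tensorEntries T) e₁)) ^ 2
      - 4 * (-(Matrix.of fun a b => T a b 0).det) * (-(MvPolynomial.eval (tensorEntries T) e₁)) ^ 3
      - 4 * (MvPolynomial.eval (tensorEntries T) e₂) ^ 3 * (Matrix.of fun a b => T a b 1).det
      - 27 * (-(Matrix.of fun a b => T a b 0).det) ^ 2 * (Matrix.of fun a b => T a b 1).det ^ 2
      + 18 * (-(Matrix.of fun a b => T a b 0).det) * (MvPolynomial.eval (tensorEntries T) e₂)
        * (-(MvPolynomial.eval (tensorEntries T) e₁)) * (Matrix.of fun a b => T a b 1).det := by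
    intro T
    simp only [Δ, map_add, map_sub, map_mul, map_pow, map_neg, map_ofNat, hdet]
  refine ⟨(X 0).det * Δ, ?_, ?_⟩
  · /- `p ≠ 0`: evaluate at the tensor with slices `1, diag(d), 0` for three distinct `dᵢ`
      (available since an algebraically closed field is infinite). -/
    let d : Fin 3 → K := fun i => Infinite.natEmbedding K i
    have hdinj : Function.Injective d :=
      (Infinite.natEmbedding K).injective.comp Fin.val_injective
    let T₀ : Fin 3 → Fin 3 → Fin 3 → K :=
      fun a b c => ![(1 : Matrix (Fin 3) (Fin 3) K) a b, Matrix.diagonal d a b, 0] c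
    have hs0 : (Matrix.of fun a b => T₀ a b 0) = 1 := by
      ext a b
      simp [T₀]
    have hs1 : (Matrix.of fun a b => T₀ a b 1) = Matrix.diagonal d := by
      ext a b
      simp [T₀]
    intro hp
    have h := congrArg (MvPolynomial.eval (tensorEntries T₀)) hp
    rw [map_zero, map_mul, hΔ, he₁, he₂, hdet, hs0, hs1, Matrix.det_one,
      Matrix.det_diagonal, Fin.prod_univ_three, sum_det_updateCol_diagonal_one,
      sum_det_updateCol_one_diagonal, one_mul] at h
    have key : (d 0 + d 1 + d 2) ^ 2 * (-(d 1 * d 2 + d 0 * d 2 + d 0 * d 1)) ^ 2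
        - 4 * (-(1 : K)) * (-(d 1 * d 2 + d 0 * d 2 + d 0 * d 1)) ^ 3
        - 4 * (d 0 + d 1 + d 2) ^ 3 * (d 0 * d 1 * d 2)
        - 27 * (-(1 : K)) ^ 2 * (d 0 * d 1 * d 2) ^ 2
        + 18 * (-(1 : K)) * (d 0 + d 1 + d 2) * (-(d 1 * d 2 + d 0 * d 2 + d 0 * d 1))
          * (d 0 * d 1 * d 2)
        = (d 0 - d 1) ^ 2 * (d 0 - d 2) ^ 2 * (d 1 - d 2) ^ 2 := by ring
    rw [key] at h
    refine absurd h (mul_ne_zero (mul_ne_zero ?_ ?_) ?_)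
    · exact pow_ne_zero _ (sub_ne_zero.2 (hdinj.ne (by decide)))
    · exact pow_ne_zero _ (sub_ne_zero.2 (hdinj.ne (by decide)))
    · exact pow_ne_zero _ (sub_ne_zero.2 (hdinj.ne (by decide)))
  · /- `p(T) ≠ 0 ⟹ T ≤ ⟨3⟩ ⊕ ⟨1,2,1⟩` -/
    intro T hT
    rw [map_mul, hdet, hΔ, he₁, he₂] at hT
    obtain ⟨h0, hdisc⟩ := mul_ne_zero_iff.1 hT
    -- the three distinct roots of `det(M₁ - λ M₀)`
    obtain ⟨r₁, r₂, r₃, hb, hc, hd⟩ := exists_vieta_of_cubic (-(Matrix.of fun a b => T a b 0).det)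
      (∑ j, ((Matrix.of fun a b => T a b 0).updateCol j fun i => (Matrix.of fun a b => T a b 1) i j).det)
      (-(∑ j, ((Matrix.of fun a b => T a b 1).updateCol j
        fun i => (Matrix.of fun a b => T a b 0) i j).det))
      (Matrix.of fun a b => T a b 1).det (neg_ne_zero.2 h0)
    rw [disc_cubic_eq_of_vieta hb hc hd] at hdisc
    have h12 : r₁ ≠ r₂ := fun h => hdisc (by rw [h]; ring)
    have h13 : r₁ ≠ r₃ := fun h => hdisc (by rw [h]; ring)
    have h23 : r₂ ≠ r₃ := fun h => hdisc (by rw [h]; ring)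
    have hcubic : ∀ t : K, ((Matrix.of fun a b => T a b 1) - t • (Matrix.of fun a b => T a b 0)).det
        = -(Matrix.of fun a b => T a b 0).det * ((t - r₁) * (t - r₂) * (t - r₃)) := by
      intro t
      rw [det_sub_smul_fin_three]
      linear_combination t ^ 2 * hb + t * hc + hd
    have hroot : ∀ i, ((Matrix.of fun a b => T a b 1) - ![r₁, r₂, r₃] i •
        (Matrix.of fun a b => T a b 0)).det = 0 := by
      intro i
      rw [hcubic]
      fin_cases i <;> simp
    -- an eigenvalue of the third slice
    obtain ⟨s₁, s₂, s₃, hb', hc', hd'⟩ := exists_vieta_of_cubic (-(Matrix.of fun a b => T a b 0).det)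
      (∑ j, ((Matrix.of fun a b => T a b 0).updateCol j fun i => (Matrix.of fun a b => T a b 2) i j).det)
      (-(∑ j, ((Matrix.of fun a b => T a b 2).updateCol j
        fun i => (Matrix.of fun a b => T a b 0) i j).det))
      (Matrix.of fun a b => T a b 2).det (neg_ne_zero.2 h0)
    have hl : ((Matrix.of fun a b => T a b 2) - s₁ • (Matrix.of fun a b => T a b 0)).det = 0 := by
      rw [det_sub_smul_fin_three]
      linear_combination s₁ ^ 2 * hb' + s₁ * hc' + hd'
    exact restrictsTo_of_generic_slices T h0 _ (injective_vec_three h12 h13 h23) hroot s₁ hl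

/-- **The three mode orders at once**: one non-zero polynomial `p` in the entries such that
`p(T) ≠ 0` gives the restriction `T ≤ ⟨3⟩ ⊕ ⟨1,2,1⟩` for `T`, for `T` with modes `2, 3` swapped,
and for `T` with its modes cyclically permuted — "applying (Prop. 4.3) on the tensor with modes
relabeled yields the other two degenerations" (Alman–Li 2026, proof of Cor. 4.1); `p` is the product
of the polynomial of `exists_polynomial_restrictsTo` with its two relabelled copies.
[cite: AlmanLi2026, Corollary 4.1 (proof)] -/
theorem exists_polynomial_restrictsTo_three :
    ∃ p : MvPolynomial (Fin 3 × Fin 3 × Fin 3) K, p ≠ 0 ∧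
      ∀ T : Fin 3 → Fin 3 → Fin 3 → K, MvPolynomial.eval (tensorEntries T) p ≠ 0 →
        TensorRestrictsTo (directSumTensor (unitTensor K 3) (matMulTensor K 2 1 1)) T ∧
        TensorRestrictsTo (directSumTensor (unitTensor K 3) (matMulTensor K 2 1 1))
          (fun a c b => T a b c) ∧
        TensorRestrictsTo (directSumTensor (unitTensor K 3) (matMulTensor K 2 1 1))
          (fun a b c => T c a b) := by
  classical
  obtain ⟨p, hp, hpT⟩ := exists_polynomial_restrictsTo K
  -- relabellings of the entries realising the two mode permutations
  let π₂ : Fin 3 × Fin 3 × Fin 3 → Fin 3 × Fin 3 × Fin 3 := fun x => (x.1, x.2.2, x.2.1)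
  let π₃ : Fin 3 × Fin 3 × Fin 3 → Fin 3 × Fin 3 × Fin 3 := fun x => (x.2.2, x.1, x.2.1)
  have hπ₂ : Function.Injective π₂ := by
    rintro ⟨a, b, c⟩ ⟨a', b', c'⟩ h
    simp only [π₂, Prod.mk.injEq] at h
    obtain ⟨rfl, rfl, rfl⟩ := h
    rfl
  have hπ₃ : Function.Injective π₃ := by
    rintro ⟨a, b, c⟩ ⟨a', b', c'⟩ h
    simp only [π₃, Prod.mk.injEq] at h
    obtain ⟨rfl, rfl, rfl⟩ := h
    rfl
  have hev₂ : ∀ T : Fin 3 → Fin 3 → Fin 3 → K,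
      MvPolynomial.eval (tensorEntries T) (MvPolynomial.rename π₂ p) =
        MvPolynomial.eval (tensorEntries fun a c b => T a b c) p := by
    intro T
    rw [MvPolynomial.eval_rename]
    rfl
  have hev₃ : ∀ T : Fin 3 → Fin 3 → Fin 3 → K,
      MvPolynomial.eval (tensorEntries T) (MvPolynomial.rename π₃ p) =
        MvPolynomial.eval (tensorEntries fun a b c => T c a b) p := by
    intro T
    rw [MvPolynomial.eval_rename]
    rfl
  refine ⟨p * MvPolynomial.rename π₂ p * MvPolynomial.rename π₃ p,
    mul_ne_zero (mul_ne_zero hp ?_) ?_, fun T hT => ?_⟩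
  · exact fun h => hp (MvPolynomial.rename_injective π₂ hπ₂ (by rw [h, map_zero]))
  · exact fun h => hp (MvPolynomial.rename_injective π₃ hπ₃ (by rw [h, map_zero]))
  · rw [map_mul, map_mul, hev₂, hev₃] at hT
    obtain ⟨hT12, hT3⟩ := mul_ne_zero_iff.1 hT
    obtain ⟨hT1, hT2⟩ := mul_ne_zero_iff.1 hT12
    exact ⟨hpT T hT1, hpT _ hT2, hpT _ hT3⟩

end Generic

end Literature.Computability.AlgebraicComplexity

end
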